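import Summits.BirchSwinnertonDyer.BirchSwinnertonDyer.Theorems.ManinLocalTwoThreeDoublingProfileFourP
import Summits.BirchSwinnertonDyer.BirchSwinnertonDyer.Theorems.ManinLocalTwoThreeTriplingProfileNineP
import Summits.BirchSwinnertonDyer.BirchSwinnertonDyer.Theorems.ManinLocalTwoThreeTamePrimePowLevels
import HarnessLib

/-!
# The doubling / tripling profiles at the prime-power tame levels `N = 4p^k` (`p` odd) and `N = 9p^k` (`p ≡ 2 (mod 3)` odd)

Summit `BirchSwinnertonDyer`, route `ManinLocalTwoThree` (cell bsd-f2-manin), cruxes C2 `ManinOddAtFour` (stmt-…-22967) and C3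
`ManinPrimeToThreeAtNine` (stmt-…-22968).  p3-g6's `…TamePrimePowLevels` (`velu_two_of_doubled_four_mul_prime_pow`,
`velu_three_of_tripled_nine_mul_prime_pow`: Vélu rigidity of a doubled / tripled class at `4p^k` / `9p^k`) composed with this seat's
local laws (p646508/p647511 at `2`, p642603/p643391 at `3`) — the `4p` / `9p` files p647003, p649022, p642959, p649207 verbatim at
prime-power level:

* `natAbs_maninConstant₀_ne_two_mul_of_IVstar_four_mul_prime_pow`, `natAbs_maninConstant₀_eq_of_IVstar_four_mul_prime_pow`,
  `not_two_dvd_maninConstant₀_iff_of_IVstar_four_mul_prime_pow` — NO DOUBLING, `|c₀| = |c₁|`, C2(`D₀`) ⟺ `2 ∤ c₁` on the tame `IV*`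
  stratum at `N = 4p^k`; `padicValInt_minimalDiscriminantInt_of_doubled_four_mul_prime_pow` — the doubling profile (`IV`, `IV*`).
* `natAbs_maninConstant₀_ne_three_mul_of_IIIstar_nine_mul_prime_pow`, `natAbs_maninConstant₀_eq_of_IIIstar_nine_mul_prime_pow`,
  `not_three_dvd_maninConstant₀_iff_of_IIIstar_nine_mul_prime_pow` — NO TRIPLING etc. on the pot.-good `III*` stratum at `N = 9p^k`;
  `padicValInt_minimalDiscriminantInt₁_eq_nine_of_tripled_of_III_nine_mul_prime_pow` — tripled with `W₀` of type `III` ⟹ `W₁` of type `III*`.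

All granted the Modularity Theorem `exists_isNewformOf` (the cruxes' hypothesis) for `N = N(W₀) = N(W₁)`.  HONEST FRAMING: C2, C3, Manin's
conjecture and BSD are not proved.  No definitions, no named facts, no sorry.  References: [CesnaviciusNeururerSaha2023] Lemma 6.5;
[SilvermanATAEC1994] IV.9.4 Table 4.1; [DiamondShurman2005] Thm. 8.8.1; [LingOesterle1991] Thm. 6.
-/

set_option autoImplicit false
set_option linter.dupNamespace false

noncomputable section

open scoped Classical
open WeierstrassCurve Literature.NumberTheory.EllipticCurves Literature.NumberTheory.EllipticCurves.ModularForms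
open CongruenceSubgroup Polynomial

namespace Summit.BirchSwinnertonDyer.BirchSwinnertonDyer.Theorems.ManinLocalTwoThree

variable {W₁ W₀ : WeierstrassCurve ℚ} [W₁.IsElliptic] [W₁.IsGloballyMinimal] [W₀.IsElliptic]
  [W₀.IsGloballyMinimal]

/-! ### §1 `N = 4p^k` -/

omit [W₁.IsGloballyMinimal] [W₀.IsGloballyMinimal] in
/-- `4 ∥ N(W₀)` and `4 ∥ N(W₁)` at level `4p^k`, `p` odd, granted `exists_isNewformOf`. [cite: DiamondShurman2005, Thm. 8.8.1] -/
theorem four_dvd_not_eight_dvd_conductorNorm_of_level_four_mul_prime_pow (hnf : exists_isNewformOf) {p : ℕ} (hp : p.Prime)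
    (hp2 : p ≠ 2) (k : ℕ) [NeZero (4 * p ^ k)] (D₁ : Gamma1ParametrizationData W₁ (4 * p ^ k))
    (D₀ : ModularParametrizationData W₀ (4 * p ^ k)) :
    (2 ^ 2 ∣ W₀.conductorNorm ℤ ∧ ¬ 2 ^ 3 ∣ W₀.conductorNorm ℤ) ∧
      (2 ^ 2 ∣ W₁.conductorNorm ℤ ∧ ¬ 2 ^ 3 ∣ W₁.conductorNorm ℤ) := by
  have hodd : Odd (p ^ k) := (hp.odd_of_ne_two hp2).pow
  have key : 2 ^ 2 ∣ 4 * p ^ k ∧ ¬ 2 ^ 3 ∣ 4 * p ^ k := by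
    refine ⟨⟨p ^ k, by ring⟩, fun h ↦ ?_⟩
    obtain ⟨m, hm⟩ := hodd
    have : 8 ∣ 4 * p ^ k := by simpa using h
    omega
  have hN₀ : 4 * p ^ k = W₀.conductorNorm ℤ := IsNewformOf.level_eq_conductorNorm_of_exists_isNewformOf hnf D₀.isNewformOf
  have hN₁ : 4 * p ^ k = W₁.conductorNorm ℤ := IsNewformOf.level_eq_conductorNorm_of_exists_isNewformOf hnf D₁.isNewformOf
  exact ⟨hN₀ ▸ key, hN₁ ▸ key⟩

/-- **NO DOUBLING on the tame `IV*` stratum at `N = 4p^k`** (`p` odd prime; granted `exists_isNewformOf`): `ord₂ Δ_min(W₀) = 8` ⟹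
`|c₀| ≠ 2|c₁|`. [cite: CesnaviciusNeururerSaha2023, Lemma 6.5] [cite: SilvermanATAEC1994, IV.9.4 Table 4.1] -/
theorem natAbs_maninConstant₀_ne_two_mul_of_IVstar_four_mul_prime_pow (hnf : exists_isNewformOf) {p : ℕ} (hp : p.Prime)
    (hp2 : p ≠ 2) (k : ℕ) [NeZero (4 * p ^ k)] (D₁ : Gamma1ParametrizationData W₁ (4 * p ^ k))
    (D₀ : ModularParametrizationData W₀ (4 * p ^ k)) (hiso : IsIsogenous W₁ W₀) (h₁ : D₁.IsOptimal)
    (h₀ : ∀ z ∈ D₀.L.lattice, ∃ w ∈ periodLattice D₀.f, z = D₀.c * w)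
    (hΔ8 : padicValInt 2 W₀.minimalDiscriminantInt = 8) :
    D₀.maninConstant.natAbs ≠ 2 * D₁.maninConstant.natAbs := by
  intro hdbl
  haveI : Fact (Nat.Prime 2) := ⟨Nat.prime_two⟩
  obtain ⟨⟨h4₀, h8₀⟩, ⟨h4₁, h8₁⟩⟩ := four_dvd_not_eight_dvd_conductorNorm_of_level_four_mul_prime_pow hnf hp hp2 k D₁ D₀
  obtain ⟨q, hq, hc4, hc6⟩ := velu_two_of_doubled_four_mul_prime_pow hp hp2 k D₁ D₀ hiso h₁ h₀ hdbl
  have h16 := padicValInt_minimalDiscriminantInt_eq_sixteen_of_velu_two_of_IVstar W₀ h4₀ h8₀ hΔ8 q hq W₁ hc4 hc6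
  rcases padicValInt_minimalDiscriminantInt_eq_four_or_eight_of_tame_two W₁ h4₁ h8₁ with h | h <;> omega

/-- **`|c₀| = |c₁|` on the tame `IV*` stratum at `N = 4p^k`.** [cite: CesnaviciusNeururerSaha2023, Lemma 6.5] [cite: LingOesterle1991, Thm. 6] -/
theorem natAbs_maninConstant₀_eq_of_IVstar_four_mul_prime_pow (hnf : exists_isNewformOf) {p : ℕ} (hp : p.Prime)
    (hp2 : p ≠ 2) (k : ℕ) [NeZero (4 * p ^ k)] (D₁ : Gamma1ParametrizationData W₁ (4 * p ^ k))
    (D₀ : ModularParametrizationData W₀ (4 * p ^ k)) (hiso : IsIsogenous W₁ W₀) (h₁ : D₁.IsOptimal)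
    (h₀ : ∀ z ∈ D₀.L.lattice, ∃ w ∈ periodLattice D₀.f, z = D₀.c * w)
    (hΔ8 : padicValInt 2 W₀.minimalDiscriminantInt = 8) :
    D₀.maninConstant.natAbs = D₁.maninConstant.natAbs :=
  (natAbs_maninConstant₀_eq_or_eq_two_mul_of_four_dvd_level D₁ D₀ hiso h₁ h₀ ⟨p ^ k, rfl⟩).resolve_right
    (natAbs_maninConstant₀_ne_two_mul_of_IVstar_four_mul_prime_pow hnf hp hp2 k D₁ D₀ hiso h₁ h₀ hΔ8)

/-- **C2 on the optimal curve ⟺ `2 ∤ c₁`, on the tame `IV*` stratum at `N = 4p^k`.** [cite: CesnaviciusNeururerSaha2023, Lemma 6.5] -/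
theorem not_two_dvd_maninConstant₀_iff_of_IVstar_four_mul_prime_pow (hnf : exists_isNewformOf) {p : ℕ} (hp : p.Prime)
    (hp2 : p ≠ 2) (k : ℕ) [NeZero (4 * p ^ k)] (D₁ : Gamma1ParametrizationData W₁ (4 * p ^ k))
    (D₀ : ModularParametrizationData W₀ (4 * p ^ k)) (hiso : IsIsogenous W₁ W₀) (h₁ : D₁.IsOptimal)
    (h₀ : ∀ z ∈ D₀.L.lattice, ∃ w ∈ periodLattice D₀.f, z = D₀.c * w)
    (hΔ8 : padicValInt 2 W₀.minimalDiscriminantInt = 8) :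
    ¬ (2 : ℤ) ∣ D₀.maninConstant ↔ ¬ (2 : ℤ) ∣ D₁.maninConstant := by
  have heq := natAbs_maninConstant₀_eq_of_IVstar_four_mul_prime_pow hnf hp hp2 k D₁ D₀ hiso h₁ h₀ hΔ8
  rw [← Int.natAbs_dvd_natAbs, ← Int.natAbs_dvd_natAbs (b := D₁.maninConstant), heq]

/-- **The doubling profile at `N = 4p^k`:** `|c₀| = 2|c₁|` ⟹ `ord₂ Δ_min(W₀) = 4 ∧ ord₂ Δ_min(W₁) = 8`.
[cite: CesnaviciusNeururerSaha2023, Lemma 6.5] [cite: SilvermanATAEC1994, IV.9.4 Table 4.1] -/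
theorem padicValInt_minimalDiscriminantInt_of_doubled_four_mul_prime_pow (hnf : exists_isNewformOf) {p : ℕ} (hp : p.Prime)
    (hp2 : p ≠ 2) (k : ℕ) [NeZero (4 * p ^ k)] (D₁ : Gamma1ParametrizationData W₁ (4 * p ^ k))
    (D₀ : ModularParametrizationData W₀ (4 * p ^ k)) (hiso : IsIsogenous W₁ W₀) (h₁ : D₁.IsOptimal)
    (h₀ : ∀ z ∈ D₀.L.lattice, ∃ w ∈ periodLattice D₀.f, z = D₀.c * w)
    (hdbl : D₀.maninConstant.natAbs = 2 * D₁.maninConstant.natAbs) :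
    padicValInt 2 W₀.minimalDiscriminantInt = 4 ∧ padicValInt 2 W₁.minimalDiscriminantInt = 8 := by
  obtain ⟨⟨h4₀, h8₀⟩, -⟩ := four_dvd_not_eight_dvd_conductorNorm_of_level_four_mul_prime_pow hnf hp hp2 k D₁ D₀
  have hΔ4 : padicValInt 2 W₀.minimalDiscriminantInt = 4 := by
    rcases padicValInt_minimalDiscriminantInt_eq_four_or_eight_of_tame_two W₀ h4₀ h8₀ with h | h
    · exact h
    · exact absurd hdbl (natAbs_maninConstant₀_ne_two_mul_of_IVstar_four_mul_prime_pow hnf hp hp2 k D₁ D₀ hiso h₁ h₀ h)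
  obtain ⟨q, hq, hc4, hc6⟩ := velu_two_of_doubled_four_mul_prime_pow hp hp2 k D₁ D₀ hiso h₁ h₀ hdbl
  exact ⟨hΔ4, (exists_isGloballyMinimal_velu_two_of_IV W₀ h4₀ h8₀ hΔ4 q hq).2 W₁ hc4 hc6⟩

/-! ### §2 `N = 9p^k` -/

omit [W₁.IsElliptic] [W₁.IsGloballyMinimal] [W₀.IsGloballyMinimal] in
/-- `9 ∥ N(W₀)` at level `9p^k`, `p ≡ 2 (mod 3)`, granted `exists_isNewformOf`. [cite: DiamondShurman2005, Thm. 8.8.1] -/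
theorem nine_dvd_not_twentyseven_dvd_conductorNorm_of_level_nine_mul_prime_pow (hnf : exists_isNewformOf) {p : ℕ}
    (hp : p.Prime) (hp3 : p % 3 = 2) (k : ℕ) [NeZero (9 * p ^ k)] (D₀ : ModularParametrizationData W₀ (9 * p ^ k)) :
    3 ^ 2 ∣ W₀.conductorNorm ℤ ∧ ¬ 3 ^ 3 ∣ W₀.conductorNorm ℤ := by
  have hN : 9 * p ^ k = W₀.conductorNorm ℤ := IsNewformOf.level_eq_conductorNorm_of_exists_isNewformOf hnf D₀.isNewformOf
  rw [← hN]
  refine ⟨⟨p ^ k, rfl⟩, fun h ↦ ?_⟩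
  have h3 : 3 ∣ p ^ k := by
    have h27 : 9 * 3 ∣ 9 * p ^ k := by simpa [show (3 : ℕ) ^ 3 = 9 * 3 by norm_num] using h
    exact Nat.dvd_of_mul_dvd_mul_left (by norm_num : 0 < 9) h27
  have hp3' : 3 ∣ p := Nat.prime_three.dvd_of_dvd_pow h3
  have := (Nat.prime_dvd_prime_iff_eq Nat.prime_three hp).mp hp3'
  omega

/-- **NO TRIPLING on the pot.-good `III*` stratum at `N = 9p^k`** (`p ≡ 2 (mod 3)` odd prime; granted `exists_isNewformOf`).
[cite: CesnaviciusNeururerSaha2023, Lemma 6.5] [cite: SilvermanATAEC1994, IV.9.4 Table 4.1] -/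
theorem natAbs_maninConstant₀_ne_three_mul_of_IIIstar_nine_mul_prime_pow (hnf : exists_isNewformOf) {p : ℕ} (hp : p.Prime)
    (hp2 : p ≠ 2) (hp3 : p % 3 = 2) (k : ℕ) [NeZero (9 * p ^ k)] (D₁ : Gamma1ParametrizationData W₁ (9 * p ^ k))
    (D₀ : ModularParametrizationData W₀ (9 * p ^ k)) (hiso : IsIsogenous W₁ W₀) (h₁ : D₁.IsOptimal)
    (h₀ : ∀ z ∈ D₀.L.lattice, ∃ w ∈ periodLattice D₀.f, z = D₀.c * w)
    (hΔ9 : padicValInt 3 W₀.minimalDiscriminantInt = 9) (hj : 0 ≤ padicValRat 3 W₀.j) :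
    D₀.maninConstant.natAbs ≠ 3 * D₁.maninConstant.natAbs := by
  intro htri
  obtain ⟨h9, h27⟩ := nine_dvd_not_twentyseven_dvd_conductorNorm_of_level_nine_mul_prime_pow hnf hp hp3 k D₀
  obtain ⟨q, hq, h4, h6⟩ := velu_three_of_tripled_nine_mul_prime_pow hp hp2 hp3 k D₁ D₀ hiso h₁ h₀ htri
  exact not_exists_isGloballyMinimal_velu_three_of_IIIstar W₀ h9 h27 hΔ9 hj q hq ⟨W₁, ‹_›, ‹_›, h4, h6⟩

/-- **`|c₀| = |c₁|` on the pot.-good `III*` stratum at `N = 9p^k`.** [cite: CesnaviciusNeururerSaha2023, Lemma 6.5] [cite: LingOesterle1991, Thm. 6] -/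
theorem natAbs_maninConstant₀_eq_of_IIIstar_nine_mul_prime_pow (hnf : exists_isNewformOf) {p : ℕ} (hp : p.Prime)
    (hp2 : p ≠ 2) (hp3 : p % 3 = 2) (k : ℕ) [NeZero (9 * p ^ k)] (D₁ : Gamma1ParametrizationData W₁ (9 * p ^ k))
    (D₀ : ModularParametrizationData W₀ (9 * p ^ k)) (hiso : IsIsogenous W₁ W₀) (h₁ : D₁.IsOptimal)
    (h₀ : ∀ z ∈ D₀.L.lattice, ∃ w ∈ periodLattice D₀.f, z = D₀.c * w)
    (hΔ9 : padicValInt 3 W₀.minimalDiscriminantInt = 9) (hj : 0 ≤ padicValRat 3 W₀.j) :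
    D₀.maninConstant.natAbs = D₁.maninConstant.natAbs :=
  (natAbs_maninConstant₀_eq_or_eq_three_mul_of_nine_dvd_level D₁ D₀ hiso h₁ h₀ ⟨p ^ k, rfl⟩).resolve_right
    (natAbs_maninConstant₀_ne_three_mul_of_IIIstar_nine_mul_prime_pow hnf hp hp2 hp3 k D₁ D₀ hiso h₁ h₀ hΔ9 hj)

/-- **C3 on the optimal curve ⟺ `3 ∤ c₁`, on the pot.-good `III*` stratum at `N = 9p^k`.** [cite: CesnaviciusNeururerSaha2023, Lemma 6.5] -/
theorem not_three_dvd_maninConstant₀_iff_of_IIIstar_nine_mul_prime_pow (hnf : exists_isNewformOf) {p : ℕ} (hp : p.Prime)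
    (hp2 : p ≠ 2) (hp3 : p % 3 = 2) (k : ℕ) [NeZero (9 * p ^ k)] (D₁ : Gamma1ParametrizationData W₁ (9 * p ^ k))
    (D₀ : ModularParametrizationData W₀ (9 * p ^ k)) (hiso : IsIsogenous W₁ W₀) (h₁ : D₁.IsOptimal)
    (h₀ : ∀ z ∈ D₀.L.lattice, ∃ w ∈ periodLattice D₀.f, z = D₀.c * w)
    (hΔ9 : padicValInt 3 W₀.minimalDiscriminantInt = 9) (hj : 0 ≤ padicValRat 3 W₀.j) :
    ¬ (3 : ℤ) ∣ D₀.maninConstant ↔ ¬ (3 : ℤ) ∣ D₁.maninConstant := by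
  have heq := natAbs_maninConstant₀_eq_of_IIIstar_nine_mul_prime_pow hnf hp hp2 hp3 k D₁ D₀ hiso h₁ h₀ hΔ9 hj
  rw [← Int.natAbs_dvd_natAbs, ← Int.natAbs_dvd_natAbs (b := D₁.maninConstant), heq]

/-- **The tripling profile at `N = 9p^k`:** tripled with `W₀` of type `III` ⟹ `W₁` of type `III*`.
[cite: SilvermanATAEC1994, IV.9.4 Table 4.1] [cite: CesnaviciusNeururerSaha2023, Lemma 6.5] -/
theorem padicValInt_minimalDiscriminantInt₁_eq_nine_of_tripled_of_III_nine_mul_prime_pow (hnf : exists_isNewformOf)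
    {p : ℕ} (hp : p.Prime) (hp2 : p ≠ 2) (hp3 : p % 3 = 2) (k : ℕ) [NeZero (9 * p ^ k)]
    (D₁ : Gamma1ParametrizationData W₁ (9 * p ^ k)) (D₀ : ModularParametrizationData W₀ (9 * p ^ k))
    (hiso : IsIsogenous W₁ W₀) (h₁ : D₁.IsOptimal)
    (h₀ : ∀ z ∈ D₀.L.lattice, ∃ w ∈ periodLattice D₀.f, z = D₀.c * w)
    (hΔ3 : padicValInt 3 W₀.minimalDiscriminantInt = 3)
    (htri : D₀.maninConstant.natAbs = 3 * D₁.maninConstant.natAbs) :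
    padicValInt 3 W₁.minimalDiscriminantInt = 9 := by
  obtain ⟨h9, h27⟩ := nine_dvd_not_twentyseven_dvd_conductorNorm_of_level_nine_mul_prime_pow hnf hp hp3 k D₀
  obtain ⟨q, hq, h4, h6⟩ := velu_three_of_tripled_nine_mul_prime_pow hp hp2 hp3 k D₁ D₀ hiso h₁ h₀ htri
  exact padicValInt_minimalDiscriminantInt_eq_nine_of_velu_three_of_III W₀ h9 h27 hΔ3 q hq W₁ h4 h6

end Summit.BirchSwinnertonDyer.BirchSwinnertonDyer.Theorems.ManinLocalTwoThree

end
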